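import Summits.AtomisticToContinuum.Crystallization.Theses.PhononSlackCertificates
import Summits.AtomisticToContinuum.Crystallization.Theorems.PhononSlackCertificatesWindowOptimalityMatch

/-!
# Route `PhononSlackCertificates`, item `WindowOptimality` (stmt-AtomisticToContinuum-13962), part IV: conclusion

**Windows of ground states are optimal.**  If a periodic configuration `P` of `ℝ³` is two-way
`ε`-matched on `B(0, R)` by translates of Lennard-Jones ground states `x^N`, frequently in `N`, for
every `R` and every `ε > 0`, then `e(P)` is the least energy per particle over all periodic
configurations (`windowOptimality_proof`, closing the route decl
`PhononSlackCertificates.WindowOptimality`).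

Proof (cut, without paste).  It suffices to show `e(P) ≤ e* = ⨅_Q e(Q)` (`e* ≤ e(Q)` is item 0714,
`ChargedEnergyGapNegative.eStar_le`).  Given `η > 0` choose, in this order: the separation `δ` of
ground states (`LennardJonesMinimalDistance_holds`) and `s_P` of `P`; a locality radius `L` with
far sixth-power sums `farSum P L ≤ η·#F` and particle tail `τ(L) ≤ η`; the uniform near count `n`;
a block size `k` with `E(M)/M ≤ e* + η` for `M = #F·k³` (`crysEnergyLimit`, item 0626) and boundary
layer `≤ η M`; the modulus `ω = η/(n+1)`; then `ε` so small that `V_LJ` moves by `≤ ω` at every near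
distance of the block (finitely many) and `2ε < δ, s_P`; then `R` containing the `L`-neighbourhood
of the block; then `N > M` and `t` from the hypothesis.  Part III bounds the energy carried by the
`M` particles matched to the block from below by `2M e(P) − O(η)M`, part I bounds it from above by
`2E(M) ≤ 2M(e* + η)`; hence `e(P) ≤ e* + 4η`.
-/

noncomputable section

namespace Summit.AtomisticToContinuum.Crystallization.Theorems

open Literature.MathematicalPhysics.StatisticalMechanics
open Summit.AtomisticToContinuum.Crystallization.Theorems.ChargedEnergyGapNegative
open Summit.AtomisticToContinuum.Crystallization.Theorems.PhononSlackWindowOptimality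
open scoped BigOperators Topology
open Filter

/-- **The energy per particle of a window of ground states is at most `e*`.**  For a sequence of
Lennard-Jones ground states `x^N` and a periodic `P` two-way `ε`-matched on `B(0,R)` by translates
of `x^N` frequently in `N`, for all `R`, `ε > 0`: `e(P) ≤ ⨅_Q e(Q)`.  (Cut-and-compare: the `M`
particles matched to a block of `P` carry energy `≥ 2M e(P) − o(M)` and `< 2E(M) = 2M e* + o(M)`.)
[folklore] -/
theorem PhononSlackWindowOptimality.energyPerParticle_le_eStar
    (x : (N : ℕ) → (Fin N → EuclideanSpace ℝ (Fin 3)))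
    (hx : ∀ N, IsGroundState lennardJones (x N)) (P : PeriodicConfiguration 3)
    (hP : ∀ R ε : ℝ, 0 < ε → ∃ᶠ N in atTop, ∃ t : EuclideanSpace ℝ (Fin 3),
      (∀ s ∈ P.points, ‖s‖ ≤ R → ∃ i : Fin N, dist (x N i + t) s ≤ ε) ∧
      (∀ i : Fin N, ‖x N i + t‖ ≤ R → ∃ s ∈ P.points, dist (x N i + t) s ≤ ε)) :
    P.energyPerParticle lennardJones ≤ eStar := by
  classical
  -- constants of the problem
  obtain ⟨δ, hδ, hsepx⟩ := LennardJonesMinimalDistance_holds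
  obtain ⟨sP, hsP0, hsP⟩ := exists_sep P
  have hFpos : (0 : ℝ) < P.motif.card := by exact_mod_cast P.motif_nonempty.card_pos
  refine le_of_forall_pos_le_add fun η4 hη4 => ?_
  set η : ℝ := η4 / 4 with hηdef
  have hη : 0 < η := by positivity
  -- (1) the locality radius `L`
  obtain ⟨ρ₀, hρ₀⟩ := Blocks.exists_farSum_le P (show 0 < η * P.motif.card by positivity)
  set L : ℝ := max (max 1 (2 * δ)) (max ρ₀ (4096 / (3 * δ ^ 3 * η))) with hLdef
  have hL1 : 1 ≤ L := le_trans (le_max_left _ _) (le_max_left _ _)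
  have hδL : δ ≤ L / 2 := by
    have : 2 * δ ≤ L := le_trans (le_max_right _ _) (le_max_left _ _)
    linarith
  have hfar : Blocks.farSum P L ≤ η * P.motif.card :=
    hρ₀ L (le_trans (le_max_left _ _) (le_max_right _ _))
  have hτ : 1 / 6 * (1024 / (δ ^ 3 * (L / 2) ^ 3)) ≤ η := by
    have hδ3 : 0 < δ ^ 3 := by positivity
    have hL0 : 0 < L := by linarith
    have hLL : L ≤ L ^ 3 := by
      have h := mul_nonneg (mul_nonneg hL0.le (sub_nonneg.2 hL1)) (by linarith : (0 : ℝ) ≤ L + 1)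
      nlinarith [h]
    have h1 : 4096 / (3 * δ ^ 3 * η) ≤ L := le_trans (le_max_right _ _) (le_max_right _ _)
    rw [div_le_iff₀ (by positivity)] at h1
    rw [show 1 / 6 * (1024 / (δ ^ 3 * (L / 2) ^ 3)) = 4096 / (3 * (δ ^ 3 * L ^ 3)) by
      field_simp; ring]
    rw [div_le_iff₀ (by positivity)]
    nlinarith [mul_le_mul_of_nonneg_left hLL (by positivity : (0 : ℝ) ≤ 3 * δ ^ 3 * η)]
  -- (2) the uniform near count `n`
  obtain ⟨n, hn⟩ := exists_near_card_le P L
  -- (3) the block size `k`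
  have hev : ∀ᶠ M : ℕ in atTop, groundStateEnergy lennardJones 3 M / M ≤ eStar + η :=
    crysEnergyLimit.eventually (eventually_le_nhds (lt_add_of_pos_right eStar hη))
  obtain ⟨M₀, hM₀⟩ := eventually_atTop.1 hev
  obtain ⟨k, hk⟩ := exists_nat_ge (max (M₀ : ℝ) (max 1 ((n : ℝ) * Blocks.depth P L / (2 * η))))
  have hk1 : 1 ≤ k := by
    have : (1 : ℝ) ≤ k := le_trans (le_trans (le_max_left _ _) (le_max_right _ _)) hk
    exact_mod_cast this
  have hkM₀ : M₀ ≤ k := by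
    have : (M₀ : ℝ) ≤ k := le_trans (le_max_left _ _) hk
    exact_mod_cast this
  have hkb : (n : ℝ) * Blocks.depth P L / (2 * η) ≤ k :=
    le_trans (le_trans (le_max_right _ _) (le_max_right _ _)) hk
  set M : ℕ := Fintype.card (Blocks.BIdx P k) with hMdef
  have hMeq : (M : ℝ) = P.motif.card * (k : ℝ) ^ 3 := by
    rw [hMdef, Blocks.card_BIdx]; push_cast; ring
  have hkM : k ≤ M := by
    rw [hMdef, Blocks.card_BIdx]
    exact (Nat.le_self_pow three_ne_zero k).trans
      (Nat.le_mul_of_pos_left _ P.motif_nonempty.card_pos)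
  have hM₀M : M₀ ≤ M := hkM₀.trans hkM
  have hMpos : 0 < M := lt_of_lt_of_le hk1 hkM
  have hMr : (0 : ℝ) < M := by exact_mod_cast hMpos
  have hEM : groundStateEnergy lennardJones 3 M ≤ M * (eStar + η) := by
    have := hM₀ M hM₀M
    rwa [div_le_iff₀ hMr, mul_comm] at this
  -- (4) the modulus `ω` and the near finsets of the block
  set ω : ℝ := η / (n + 1) with hωdef
  have hn0 : (0 : ℝ) ≤ n := Nat.cast_nonneg n
  have hωpos : 0 < ω := by positivity
  have hωn : ω * n ≤ η := by
    rw [hωdef, div_mul_eq_mul_div, div_le_iff₀ (by positivity)]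
    nlinarith
  choose F hF using fun u : Blocks.BIdx P k => exists_nearFinset P (Blocks.bpt P k u) L
  have hnF : ∀ u, (F u).card ≤ n := fun u => hn k u (F u) (hF u)
  -- (5) the matching precision `ε`
  have hevε : ∀ᶠ ε in 𝓝[>] (0 : ℝ), (0 < ε ∧ 2 * ε < δ ∧ 2 * ε < sP ∧ ε < 1 / 4) ∧
      ∀ u : Blocks.BIdx P k, ∀ q ∈ F u, ∀ r : ℝ, |r - dist (Blocks.bpt P k u) q.1| ≤ 2 * ε →
        lennardJones (dist (Blocks.bpt P k u) q.1) - ω ≤ lennardJones r := by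
    refine Filter.Eventually.and ?_ ?_
    · have h0 : ∀ᶠ ε in 𝓝[>] (0 : ℝ), 0 < ε := eventually_mem_nhdsWithin
      have h1 : ∀ᶠ ε in 𝓝[>] (0 : ℝ), ε < δ / 2 :=
        (eventually_lt_nhds (half_pos hδ)).filter_mono nhdsWithin_le_nhds
      have h2 : ∀ᶠ ε in 𝓝[>] (0 : ℝ), ε < sP / 2 :=
        (eventually_lt_nhds (half_pos hsP0)).filter_mono nhdsWithin_le_nhds
      have h3 : ∀ᶠ ε in 𝓝[>] (0 : ℝ), ε < 1 / 4 :=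
        (eventually_lt_nhds (by norm_num : (0 : ℝ) < 1 / 4)).filter_mono nhdsWithin_le_nhds
      filter_upwards [h0, h1, h2, h3] with ε a b c d
      exact ⟨a, by linarith, by linarith, d⟩
    · rw [eventually_all]
      intro u
      rw [eventually_all_finset]
      intro q _
      exact eventually_sub_le_lennardJones (dist_ne_zero.2 fun h => q.2.2 h.symm) hωpos
  obtain ⟨ε, ⟨hε0, hεδ, hεP, hε4⟩, hωε⟩ := hevε.exists
  have hεL : 4 * ε ≤ L := by linarith
  -- (6) the radius `R`, then `N > M` and the translation `t` from the window hypothesis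
  obtain ⟨B, -, hB⟩ := exists_norm_bpt_le P k
  set R : ℝ := B + L + 1 with hRdef
  have hR : ∀ u : Blocks.BIdx P k, ‖Blocks.bpt P k u‖ + L ≤ R - ε := fun u => by
    have := hB u; rw [hRdef]; linarith
  obtain ⟨N, ⟨t, hcover, hfit⟩, hNM⟩ :=
    ((hP R ε hε0).and_eventually (eventually_ge_atTop (M + 1))).exists
  -- (7) the translated ground state `y` and the matching `π`
  set y : Fin N → EuclideanSpace ℝ (Fin 3) := fun i => x N i + t with hydef
  have hyg : IsGroundState lennardJones y :=
    ⟨fun i j h => (hx N).1 (add_right_cancel h), by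
      rw [hydef, interactionEnergy_add_const]; exact (hx N).2⟩
  have hsep : ∀ i j, i ≠ j → δ ≤ dist (y i) (y j) := fun i j hij => by
    have e : dist (y i) (y j) = dist (x N i) (x N j) := dist_add_right _ _ _
    rw [e]; exact hsepx N (x N) (hx N) i j hij
  haveI : Nonempty (Fin N) := ⟨⟨0, by omega⟩⟩
  choose! π hπ using hcover
  have hπ' : ∀ s ∈ P.points, ‖s‖ ≤ R → dist (y (π s)) s ≤ ε := fun s hs hsR => hπ s hs hsR
  have hfit' : ∀ i, ‖y i‖ ≤ R → ∃ s ∈ P.points, dist (y i) s ≤ ε := fun i hi => hfit i hi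
  -- the matched block `W`
  set W : Finset (Fin N) := Finset.univ.image fun u : Blocks.BIdx P k => π (Blocks.bpt P k u)
    with hW
  have hbR : ∀ u : Blocks.BIdx P k, ‖Blocks.bpt P k u‖ ≤ R := fun u => by linarith [hR u]
  have hinj : Function.Injective fun u : Blocks.BIdx P k => π (Blocks.bpt P k u) := fun u v h =>
    Blocks.bpt_injective P k (pi_inj hsP hεP hπ' (Blocks.bpt_mem P k u) (Blocks.bpt_mem P k v)
      (hbR u) (hbR v) h)
  have hWcard : W.card = M := by rw [hW, Finset.card_image_of_injective _ hinj, Finset.card_univ]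
  have hWpos : 0 < W.card := by rw [hWcard]; exact hMpos
  have hWc : 0 < Wᶜ.card := by
    rw [Finset.card_compl, Fintype.card_fin, hWcard]; omega
  -- (8) the two bounds
  have hlow := block_lower_bound hδ hsep hsP hεδ hεP hε0.le hπ' hfit' hL1 hδL hεL k hR F hF hnF
    hωpos.le hωε W hW
  have hcut := cut_lt hyg W hWpos hWc
  rw [hWcard] at hcut
  -- (9) arithmetic
  rw [← hMdef] at hlow
  have hk0 : (0 : ℝ) ≤ (k : ℝ) ^ 3 := by positivity
  have h2 : (k : ℝ) ^ 3 * Blocks.farSum P L ≤ η * M :=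
    calc (k : ℝ) ^ 3 * Blocks.farSum P L ≤ (k : ℝ) ^ 3 * (η * P.motif.card) :=
          mul_le_mul_of_nonneg_left hfar hk0
      _ = η * M := by rw [hMeq]; ring
  have hηM : 0 ≤ η * M := by positivity
  have h3 : (ω * n + 2 * (1 / 6 * (1024 / (δ ^ 3 * (L / 2) ^ 3)))) * (M : ℝ) ≤ 3 * η * M :=
    mul_le_mul_of_nonneg_right (by linarith) hMr.le
  have h4 : (n : ℝ) / 12 * (P.motif.card * (6 * Blocks.depth P L * (k : ℝ) ^ 2)) ≤ η * M := by
    have hnd : (n : ℝ) * Blocks.depth P L ≤ 2 * η * k := by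
      have := hkb
      rw [div_le_iff₀ (by positivity)] at this
      linarith
    calc (n : ℝ) / 12 * (P.motif.card * (6 * Blocks.depth P L * (k : ℝ) ^ 2))
        = 1 / 2 * ((n : ℝ) * Blocks.depth P L) * (P.motif.card * (k : ℝ) ^ 2) := by ring
      _ ≤ 1 / 2 * (2 * η * k) * (P.motif.card * (k : ℝ) ^ 2) := by gcongr
      _ = η * (P.motif.card * (k : ℝ) ^ 3) := by ring
      _ = η * M := by rw [hMeq]
  have hkey : (k : ℝ) ^ 3 * (2 * P.motif.card * P.energyPerParticle lennardJones) =
      2 * M * P.energyPerParticle lennardJones := by rw [hMeq]; ring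
  have hfin : 2 * (M : ℝ) * P.energyPerParticle lennardJones ≤
      2 * M * eStar + M * (7 * η) := by
    linarith [hlow, hcut, hEM, h2, h3, h4, hkey, hηM]
  have hfin' : P.energyPerParticle lennardJones ≤ eStar + 7 / 2 * η := by
    by_contra hlt
    rw [not_le] at hlt
    have := mul_lt_mul_of_pos_left hlt (by positivity : (0 : ℝ) < 2 * M)
    linarith [this]
  rw [hηdef] at hfin'
  linarith

/-- **Item stmt-AtomisticToContinuum-13962 `WindowOptimality`** (route `PhononSlackCertificates`):
a periodic configuration two-way `ε`-matched on every ball by translates of Lennard-Jones ground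
states, frequently in `N`, is a LEAST-energy periodic configuration: its energy per particle is
`≤ e* = ⨅_Q e(Q)` (`energyPerParticle_le_eStar`, cut-and-compare) and `e* ≤ e(Q)` for every periodic
`Q` (item 0714).  Mechanism: Blanc–Lewin 2015 §1.3 / Sütő 2006 §3.4 trial-state surgery, here in
the canonical finite-`N` setting. [folklore] -/
theorem windowOptimality_proof :
    Summit.AtomisticToContinuum.Crystallization.Theses.PhononSlackCertificates.WindowOptimality := by
  unfold Summit.AtomisticToContinuum.Crystallization.Theses.PhononSlackCertificates.WindowOptimality
  intro x hx P hP
  refine ⟨⟨P, rfl⟩, ?_⟩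
  rintro _ ⟨Q, rfl⟩
  exact (PhononSlackWindowOptimality.energyPerParticle_le_eStar x hx P hP).trans (eStar_le Q)

end Summit.AtomisticToContinuum.Crystallization.Theorems

end
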